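import Summits.ResolutionOfSingularities.ResolutionOfSingularities.Theorems.EquisingularLiftEquisingularLiftSingFiniteOfLeTwo
import Summits.ResolutionOfSingularities.ResolutionOfSingularities.Theorems.EquisingularLiftEquisingularLiftNatNoseResidueCore
import HarnessLib

/-!
# [OURS · L1 W4.5(b) · EL♮(3)] NOSE RESIDUE STRUCTURE, brick 2 — the SINGULAR CURVES of a residue `H` exist, and the class₂ dichotomy on them

Cell `res-hironaka`, rung L, slot W4.5(b), D-0157 DOOR 1 width seat `res-L1-w45b-nose-w4` (desk WIDTH TABLE D1 row nose-w4; desk word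
2026-08-28T14:53:26Z «Q-w4 ANSWERED: (ii) — the top-locus curve of class₂ ∨ not dichotomy over `IsLiftableNoseClass₂` for the reduced 1-dim part of
Sing H»); crux CHILD EL♮(3) = stmt-ResolutionOfSingularities-20148 (parent EL♮ stmt-…-20038). OURS; NOT a statement of any manuscript; nothing of
[Hironaka2017] is asserted or used; AI kernel work, weaker than expert review. Resolution of singularities in positive characteristic is NOT proved here
(dimension 3 is a theorem in print, Cossart–Piltant 2008/2009). No `sorry`, no new definition, no instance, no notation; standard axioms.
`--kind proof --supports stmt-ResolutionOfSingularities-20148 --as helper`.  Sister files: `…NatNoseResidueUnfold` (brick 1a), `…NatNoseResidueCore` (brick 1b).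

The registered nose residue `stub_elnat_three_nonisolated_nonDefNoseTowerBTriplePrime` binds an INTEGRAL closed `ι : H ↪ ℙⁿ_k` whose non-regular locus
`{x : H | ¬ IsRegularLocalRing 𝒪_{H,x}}` is INFINITE.  This file supplies the object every nose engine quantifies over:

* `exists_isIrreducible_infinite_subset_of_isClosed` — topology: in a Noetherian space an infinite closed set contains an infinite IRREDUCIBLE closed subset
  (one of its finitely many irreducible components is infinite).
* `exists_singularCurve` — for `ι : H ↪ ℙⁿ_k` a closed immersion, `H` integral with infinite non-regular locus: there is a closed, irreducible, INFINITE
  `Z ⊆ ι(Sing H) ⊆ ι(H)` with `ι(H) ⊄ Z` (the generic point of `H` is regular) — a «singular curve» of `H` in the ambient `ℙⁿ_k`, i.e. nose DATA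
  `(Z, hZ, Z ⊆ range ι, ¬ range ι ⊆ Z, Z.Infinite)` of the shape the unfolded hypotheses `not_reachNoseTower…_iff` / `not_noseHypLiftClassTwo_iff`
  consume.  Ingredients (tree): `StrataSplit.isNoetherian_and_isQuasiExcellent_of_isClosedImmersion_projectiveSpace` (H is Noetherian and quasi-excellent),
  `Scheme.isOpen_regularLocus_of_isQuasiExcellent` (J-2), `genericPoint_mem_regularLocus`.
* `nose_residue_singularCurve_dichotomy` — THE DICHOTOMY for the planner's next nose re-cut, under the core hypothesis `¬ NoseHypLiftClassTwo` alone: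
  such a `Z` exists and EITHER (A) `Z` is of the liftable nose class₂ (smooth c.i. / smooth determinantal / embedded `ℙ^r` / disjoint unions) — and then
  NO blow-up of `Z` has a regular reduced strict transform of `H` (brick 1b §4; the obstruction is PERSISTENCE after `Bl_Z`), OR (B) `Z` is NOT of class₂
  (hence not of lead-2's class either: not a smooth complete intersection, not a smooth determinantal locus, …) — the regime where a wider nose class /
  the (C)/(M) devices of CRUX-PLAN §1.3–§1.7 are needed first.  Typed ≠ proved beyond what the kernel statement says.
* §3 (at `n = 3`) THE CURVE CLAUSE — `ringKrullDim_stalk_redSub_eq_one` / `exists_singularCurve_three`: for `H` NOT regular, such a `Z` has `dim Z = 1`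
  (`dim ℙ³_k = 3`, `dim ι(H) < 3` and `dim Z < 2` by the tree's dimension drop `Literature.Topology.topologicalKrullDim_lt_of_isClosed_ssubset` /
  `…_of_forall_exists_specializes`, `dim Z > 0` since an infinite subset of the Noetherian `ℙ³_k` is not zero-dimensional), hence its reduced subscheme
  `Z̃ = redSub ℙ³ Z hZ` (integral, of finite type over `k`) has `dim 𝒪_{Z̃,z} = 1` at every CLOSED point (`ringKrullDim_stalk_eq_of_isClosed`, GW 5.22) —
  exactly the clause `∀ z, IsClosed {z} → ringKrullDim (stalk z) = 1` of `ReachNoseTower₇` / `…B` / `…BPrime` / `…BDoublePrime` / `…BTriplePrime`.  So at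
  `n = 3` the ONLY nose-data clause of the B″/B‴ engines that a singular curve of `H` can fail is CLASS₂ MEMBERSHIP.
-/

set_option linter.dupNamespace false

noncomputable section

open CategoryTheory CategoryTheory.Limits AlgebraicGeometry TopologicalSpace Topology IsLocalRing
open Literature.AlgebraicGeometry.Resolution
open Literature.AlgebraicGeometry.Motives
open AlgebraicGeometry.Scheme.IdealSheafData
open Summit.ResolutionOfSingularities.ResolutionOfSingularities.Cruxes.EquisingularLift.StrataSplit

namespace Summit.ResolutionOfSingularities.ResolutionOfSingularities.Cruxes.EquisingularLiftNat.Sections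

/-! ## Topology: an infinite closed set of a Noetherian space contains an infinite irreducible closed subset -/

/-- In a Noetherian topological space, an infinite closed set `S` contains an infinite, closed, irreducible subset (namely the image of an infinite
irreducible component of the subspace `S`; there is one since the components are finitely many and cover `S`). [folklore] -/
theorem exists_isIrreducible_infinite_subset_of_isClosed {X : Type*} [TopologicalSpace X] [NoetherianSpace X]
    {S : Set X} (hS : IsClosed S) (hinf : S.Infinite) :
    ∃ C : Set X, IsClosed C ∧ IsIrreducible C ∧ C.Infinite ∧ C ⊆ S := by
  have hfin : (irreducibleComponents S).Finite := NoetherianSpace.finite_irreducibleComponents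
  obtain ⟨C, hC, hCinf⟩ : ∃ C ∈ irreducibleComponents S, C.Infinite := by
    by_contra h
    push Not at h
    have hcov : (Set.univ : Set S) ⊆ ⋃ C ∈ irreducibleComponents S, C := fun x _ =>
      Set.mem_biUnion (irreducibleComponent_mem_irreducibleComponents x) mem_irreducibleComponent
    have huniv : (Set.univ : Set S).Finite :=
      (hfin.biUnion fun C hC => h C hC).subset hcov
    exact hinf (Set.finite_coe_iff.mp (Set.finite_univ_iff.mp huniv))
  refine ⟨Subtype.val '' C, ?_, ?_, ?_, Subtype.coe_image_subset S C⟩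
  · exact hS.isClosedEmbedding_subtypeVal.isClosedMap C (isClosed_of_mem_irreducibleComponents C hC)
  · exact hC.1.image _ continuous_subtype_val.continuousOn
  · exact hCinf.image Subtype.val_injective.injOn

/-! ## The singular curves of a residue `H` -/

/-- **A hypersurface with infinitely many singular points has a SINGULAR CURVE.** For a closed immersion `ι : H ↪ ℙⁿ_k` (`k` a field) of an integral
scheme whose non-regular locus is infinite, there is a closed irreducible infinite `Z ⊆ ℙⁿ_k` contained in the image of the non-regular locus (so
`Z ⊆ ι(H)`), with `ι(H) ⊄ Z` (the generic point of `H` is regular).  Proof: `H` is Noetherian and quasi-excellent (of finite type over a field), so its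
non-regular locus is closed (J-2) and has an infinite irreducible component; push it forward along the closed embedding `ι`. [folklore] -/
theorem exists_singularCurve (k : Type) [Field k] (n : ℕ) (H : Scheme.{0}) (ι : H ⟶ (projectiveSpace n k).left)
    [IsClosedImmersion ι] [IsIntegral H] (hinf : ¬ Set.Finite {x : H | ¬ IsRegularLocalRing (H.presheaf.stalk x)}) :
    ∃ Z : Set (projectiveSpace n k).left, IsClosed Z ∧ IsIrreducible Z ∧ Z.Infinite ∧
      Z ⊆ ι '' {x : H | ¬ IsRegularLocalRing (H.presheaf.stalk x)} ∧ Z ⊆ Set.range ι ∧ ¬ (Set.range ι ⊆ Z) := by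
  obtain ⟨hN, hqe⟩ := isNoetherian_and_isQuasiExcellent_of_isClosedImmersion_projectiveSpace n ι
  haveI := hN
  have hSc : IsClosed {x : H | ¬ IsRegularLocalRing (H.presheaf.stalk x)} :=
    (Scheme.isOpen_regularLocus_of_isQuasiExcellent hqe).isClosed_compl
  obtain ⟨C, hCc, hCirr, hCinf, hCS⟩ := exists_isIrreducible_infinite_subset_of_isClosed hSc hinf
  refine ⟨ι '' C, ι.isClosedEmbedding.isClosedMap C hCc, hCirr.image _ ι.continuous.continuousOn,
    hCinf.image ι.isClosedEmbedding.injective.injOn, Set.image_mono hCS, Set.image_subset_range _ _, ?_⟩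
  rintro hsub
  obtain ⟨x, hxC, hx⟩ := hsub (Set.mem_range_self (genericPoint H))
  have hxg : x = genericPoint H := ι.isClosedEmbedding.injective hx
  subst hxg
  exact hCS hxC (genericPoint_mem_regularLocus H)

/-- The same, packaged as NOSE DATA of the residue's shape: a closed `Z` with `Z ⊆ Set.range ι`, `¬ Set.range ι ⊆ Z`, `Z.Infinite`, irreducible and made of
(images of) non-regular points of `H` — ready to be fed to `not_reachNoseTower…_iff` / `not_noseHypLiftClassTwo_iff` (brick 1a). [folklore] -/
theorem exists_noseData_of_infinite_singular (k : Type) [Field k] (n : ℕ) (H : Scheme.{0}) (ι : H ⟶ (projectiveSpace n k).left)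
    [IsClosedImmersion ι] [IsIntegral H] (hinf : ¬ Set.Finite {x : H | ¬ IsRegularLocalRing (H.presheaf.stalk x)}) :
    ∃ (Z : Set (projectiveSpace n k).left) (_ : IsClosed Z), Z ⊆ Set.range ι ∧ ¬ (Set.range ι ⊆ Z) ∧ Z.Infinite ∧ IsIrreducible Z ∧
      ∀ z ∈ Z, ∃ x : H, ¬ IsRegularLocalRing (H.presheaf.stalk x) ∧ ι x = z := by
  obtain ⟨Z, hZc, hZirr, hZinf, hZS, hZr, hZn⟩ := exists_singularCurve k n H ι hinf
  exact ⟨Z, hZc, hZr, hZn, hZinf, hZirr, fun z hz => by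
    obtain ⟨x, hx, hxz⟩ := hZS hz
    exact ⟨x, hx, hxz⟩⟩

/-! ## The class₂ dichotomy on a singular curve (for the planner's next nose re-cut) -/

/-- **THE SINGULAR-CURVE DICHOTOMY of the nose residue.** Under the core hypothesis `¬ NoseHypLiftClassTwo k n H ι` (one of the residue's three
independent negations, brick 1b `nose_residue_hyps_iff_core`), for an integral closed `ι : H ↪ ℙⁿ_k` with infinite non-regular locus there is a singular
curve `Z` of `H` (closed, irreducible, infinite, `Z ⊆ ι(Sing H)`, `ι(H) ⊄ Z`) and EITHER
(A) `Z` IS of the liftable nose class₂ and then for EVERY blow-up `υ` of `Z` the reduced strict transform `closure υ⁻¹(ι(H) ∖ Z)` of `H` is NOT regular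
    (the obstruction is persistence of singularities after `Bl_Z`, not the liftability of `Z`), OR
(B) `Z` is NOT of class₂ — in particular not of the v1 class (`IsLiftableNoseClass`: smooth complete intersections, smooth determinantal loci, disjoint
    unions): a wider nose class, or companion/multiple devices, must come first.
[OURS · L1 W4.5b · pure logic over bricks 1b/2; typed ≠ proved beyond this statement] -/
theorem nose_residue_singularCurve_dichotomy (k : Type) [Field k] [IsAlgClosed k] (n : ℕ) (H : Scheme.{0})
    (ι : H ⟶ (projectiveSpace n k).left) [IsClosedImmersion ι] [IsIntegral H]
    (hinf : ¬ Set.Finite {x : H | ¬ IsRegularLocalRing (H.presheaf.stalk x)}) (hlc2 : ¬ NoseHypLiftClassTwo k n H ι) :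
    ∃ (Z : Set (projectiveSpace n k).left) (hZ : IsClosed Z), IsIrreducible Z ∧ Z.Infinite ∧
      Z ⊆ ι '' {x : H | ¬ IsRegularLocalRing (H.presheaf.stalk x)} ∧ Z ⊆ Set.range ι ∧ ¬ (Set.range ι ⊆ Z) ∧
      ((IsLiftableNoseClass₂ k n Z ∧
          ∀ (F₂ : Scheme.{0}) (υ : F₂ ⟶ (projectiveSpace n k).left),
            IsBlowup υ (vanishingIdeal (⟨Z, hZ⟩ : Closeds (projectiveSpace n k).left)) →
            ¬ Literature.AlgebraicGeometry.Resolution.Scheme.IsRegular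
              (vanishingIdeal (⟨closure (υ ⁻¹' (Set.range ι \ Z)), isClosed_closure⟩ : Closeds F₂)).subscheme) ∨
        (¬ IsLiftableNoseClass₂ k n Z ∧ ¬ IsLiftableNoseClass k n Z)) := by
  obtain ⟨Z, hZc, hZirr, hZinf, hZS, hZr, hZn⟩ := exists_singularCurve k n H ι hinf
  refine ⟨Z, hZc, hZirr, hZinf, hZS, hZr, hZn, ?_⟩
  by_cases hcls : IsLiftableNoseClass₂ k n Z
  · exact Or.inl ⟨hcls, fun F₂ υ hυ =>
      not_isRegular_noseStrictTransform_of_not_noseHypLiftClassTwo k n H ι hlc2 Z hZc hcls hZr hZn F₂ υ hυ⟩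
  · exact Or.inr ⟨hcls, fun h => hcls (IsLiftableNoseClass₂.base Z h)⟩

/-! ## §3 At `n = 3` a singular curve IS a curve: `dim 𝒪_{Z̃,z} = 1` at its closed points (the curve clause of the ₇/B/B′/B″/B‴ engines) -/

/-- `d < 2` and `¬ d ≤ 0` force `d = 1` in `WithBot ℕ∞`. [folklore] -/
theorem withBotENat_eq_one_of_lt_two_of_not_le_zero {d : WithBot ℕ∞} (h1 : d < (2 : ℕ)) (h2 : ¬ d ≤ 0) : d = 1 := by
  induction d using WithBot.recBotCoe with
  | bot => exact absurd bot_le h2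
  | coe e =>
    induction e using ENat.recTopCoe with
    | top => simp at h1
    | coe m =>
      have h1' : m < 2 := by
        have h : ((m : ℕ∞) : WithBot ℕ∞) < ((2 : ℕ∞) : WithBot ℕ∞) := by simpa using h1
        exact_mod_cast WithBot.coe_lt_coe.mp h
      have h2' : ¬ m ≤ 0 := by
        intro hm
        apply h2
        have : m = 0 := Nat.le_zero.mp hm
        subst this
        exact le_of_eq (by simp)
      have hm : m = 1 := by omega
      subst hm
      rfl

/-- The image `ι(H)` of a closed immersion `ι : H ↪ ℙⁿ_k` of a NON-regular scheme is a proper closed subset of `ℙⁿ_k` (a surjective closed immersion into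
the reduced `ℙⁿ_k` would be an isomorphism onto a regular scheme). [folklore] -/
theorem range_ne_univ_of_not_isRegular (k : Type) [Field k] (n : ℕ) (H : Scheme.{0}) (ι : H ⟶ (projectiveSpace n k).left)
    [IsClosedImmersion ι] (hH : ¬ Literature.AlgebraicGeometry.Resolution.Scheme.IsRegular H) : Set.range ι ≠ Set.univ := by
  intro hrange
  haveI hint : IsIntegral (projectiveSpace n k).left := isIntegral_projectiveSpace n k
  haveI : Surjective ι := ⟨Set.range_eq_univ.mp hrange⟩
  haveI : IsIso ι := isIso_of_isClosedImmersion_of_surjective ι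
  exact hH (Scheme.IsRegular.of_iso (inv ι) (isRegular_projectiveSpace n k))

/-- `dim ι(H) < n` for a closed immersion `ι : H ↪ ℙⁿ_k` of a non-regular scheme (`dim ℙⁿ_k = n`, dimension drop along a proper closed subset of the
irreducible `ℙⁿ_k`). [folklore] -/
theorem topologicalKrullDim_range_lt (k : Type) [Field k] (n : ℕ) (H : Scheme.{0}) (ι : H ⟶ (projectiveSpace n k).left)
    [IsClosedImmersion ι] (hH : ¬ Literature.AlgebraicGeometry.Resolution.Scheme.IsRegular H) :
    topologicalKrullDim (Set.range ι) < (n : ℕ) := by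
  haveI hint : IsIntegral (projectiveSpace n k).left := isIntegral_projectiveSpace n k
  haveI : SmoothOfRelativeDimension n (projectiveSpace n k).hom :=
    (isSmoothProjective_projectiveSpace_holds k n).smoothOfRelativeDimension
  have hdimP : topologicalKrullDim ↥(projectiveSpace n k).left = (n : ℕ) :=
    topologicalKrullDim_eq_of_smoothOfRelativeDimension (projectiveSpace n k).hom n
  refine Literature.Topology.topologicalKrullDim_lt_of_isClosed_ssubset ι.isClosedEmbedding.isClosed_range
    (range_ne_univ_of_not_isRegular k n H ι hH) n ?_
  rw [hdimP]
  exact_mod_cast Nat.lt_succ_self n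

/-- **Dimension drop from `ι(H)` to a proper closed subset**: for `ι : H ↪ ℙⁿ_k` a closed immersion of an integral scheme and `S ⊆ ι(H)` closed with
`ι(H) ⊄ S`, `dim ι(H) < m + 1 ⇒ dim S < m` (the generic point of `H` generises every point of `ι(H)` and is not in `S`). [folklore] -/
theorem topologicalKrullDim_lt_of_subset_range (k : Type) [Field k] (n : ℕ) (H : Scheme.{0}) (ι : H ⟶ (projectiveSpace n k).left)
    [IsClosedImmersion ι] [IsIntegral H] {S : Set (projectiveSpace n k).left} (hS : IsClosed S) (hSsub : S ⊆ Set.range ι)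
    (hSne : ¬ (Set.range ι ⊆ S)) (m : ℕ) (hdim : topologicalKrullDim (Set.range ι) < (m + 1 : ℕ)) :
    topologicalKrullDim S < (m : ℕ) := by
  refine Literature.Topology.topologicalKrullDim_lt_of_forall_exists_specializes ι.isClosedEmbedding.isClosed_range hS hSsub
    (fun z hz => ⟨ι (genericPoint H), Set.mem_range_self _, fun hξ => hSne fun y hy => ?_, ?_⟩) m hdim
  · -- if the generic point's image lay in `S`, so would every point of `ι(H)` (it specialises to all of them and `S` is closed)
    obtain ⟨x, rfl⟩ := hy
    exact (((genericPoint_spec H).specializes (Set.mem_univ x)).map ι.continuous).mem_closed hS hξ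
  · obtain ⟨x, rfl⟩ := hSsub hz
    exact ((genericPoint_spec H).specializes (Set.mem_univ x)).map ι.continuous

/-- An INFINITE subset of `ℙⁿ_k` has topological Krull dimension `> 0` (a dimension-`≤ 0` subset of the Noetherian `T₀` space `ℙⁿ_k` is finite).
[folklore] -/
theorem not_topologicalKrullDim_le_zero_of_infinite (k : Type) [Field k] (n : ℕ) {S : Set (projectiveSpace n k).left} (hSinf : S.Infinite) :
    ¬ topologicalKrullDim S ≤ 0 := by
  haveI : IsNoetherian (projectiveSpace n k).left :=
    (isNoetherian_and_isQuasiExcellent_of_isClosedImmersion_projectiveSpace n (𝟙 (projectiveSpace n k).left)).1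
  exact fun h => hSinf (Set.finite_of_topologicalKrullDim_le_zero h)

/-- **A singular curve of a surface `H ⊂ ℙ³_k` is one-dimensional**: for `ι : H ↪ ℙ³_k` a closed immersion of an integral non-regular scheme and
`S ⊆ ι(H)` closed, infinite, with `ι(H) ⊄ S`: `dim S = 1` (`dim ι(H) < 3`, `dim S < 2`, and `S` is infinite). [folklore] -/
theorem topologicalKrullDim_eq_one_of_three (k : Type) [Field k] (H : Scheme.{0}) (ι : H ⟶ (projectiveSpace 3 k).left)
    [IsClosedImmersion ι] [IsIntegral H] (hH : ¬ Literature.AlgebraicGeometry.Resolution.Scheme.IsRegular H)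
    {S : Set (projectiveSpace 3 k).left} (hS : IsClosed S) (hSinf : S.Infinite) (hSsub : S ⊆ Set.range ι) (hSne : ¬ (Set.range ι ⊆ S)) :
    topologicalKrullDim S = 1 :=
  withBotENat_eq_one_of_lt_two_of_not_le_zero
    (topologicalKrullDim_lt_of_subset_range k 3 H ι hS hSsub hSne 2 (topologicalKrullDim_range_lt k 3 H ι hH))
    (not_topologicalKrullDim_le_zero_of_infinite k 3 hSinf)

/-- **THE CURVE CLAUSE** of the nose engines ₇ / B / B′ / B″ / B‴ for a singular curve: for `ι : H ↪ ℙ³_k` a closed immersion of an integral non-regular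
scheme and `S ⊆ ι(H)` closed, IRREDUCIBLE, infinite, with `ι(H) ⊄ S`, the reduced closed subscheme `S̃ = redSub ℙ³ S hS` has `dim 𝒪_{S̃,z} = 1` at every
closed point `z` (`S̃` is an integral scheme of finite type over `k` of dimension `dim S = 1`; Görtz–Wedhorn 5.22 for the stalk). [folklore] -/
theorem ringKrullDim_stalk_redSub_eq_one (k : Type) [Field k] (H : Scheme.{0}) (ι : H ⟶ (projectiveSpace 3 k).left)
    [IsClosedImmersion ι] [IsIntegral H] (hH : ¬ Literature.AlgebraicGeometry.Resolution.Scheme.IsRegular H)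
    {S : Set (projectiveSpace 3 k).left} (hS : IsClosed S) (hSirr : IsIrreducible S) (hSinf : S.Infinite) (hSsub : S ⊆ Set.range ι)
    (hSne : ¬ (Set.range ι ⊆ S)) :
    ∀ z : ↥(redSub (projectiveSpace 3 k).left S hS), IsClosed ({z} : Set ↥(redSub (projectiveSpace 3 k).left S hS)) →
      ringKrullDim ((redSub (projectiveSpace 3 k).left S hS).presheaf.stalk z) = ((1 : ℕ) : WithBot ℕ∞) := by
  intro z hz
  haveI : IsIntegral (redSub (projectiveSpace 3 k).left S hS) := isIntegral_subscheme_vanishingIdeal ⟨S, hS⟩ hSirr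
  haveI : IsProper (projectiveSpace 3 k).hom := isProper_projectiveSpace 3 k
  let f : redSub (projectiveSpace 3 k).left S hS ⟶ Spec (.of k) := redSubι (projectiveSpace 3 k).left S hS ≫ (projectiveSpace 3 k).hom
  haveI : LocallyOfFiniteType f := inferInstance
  rw [Literature.AlgebraicGeometry.Resolution.ringKrullDim_stalk_eq_of_isClosed f hz]
  -- `dim S̃ = dim S = 1`
  have hhom : topologicalKrullDim ↥(redSub (projectiveSpace 3 k).left S hS) =
      topologicalKrullDim (Set.range (redSubι (projectiveSpace 3 k).left S hS)) :=
    IsHomeomorph.topologicalKrullDim_eq _ (redSubι (projectiveSpace 3 k).left S hS).isClosedEmbedding.isEmbedding.toHomeomorph.isHomeomorph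
  rw [hhom, range_subschemeι_vanishingIdeal]
  exact_mod_cast topologicalKrullDim_eq_one_of_three k H ι hH hS hSinf hSsub hSne

/-- **Nose data WITH the curve clause, at `n = 3`** — the ∀-prefix object of `not_reachNoseTower₇_iff` / `…B_iff` / `…BPrime_iff` / `…BDoublePrime_iff` /
`…BTriplePrime_iff`: for the residue's `H` (integral, `ι : H ↪ ℙ³_k` closed immersion, `H` not regular, infinitely many non-regular points) there is a
closed irreducible infinite `Z ⊆ ι(Sing H)` with `ι(H) ⊄ Z` whose reduced subscheme has one-dimensional local rings at closed points.  (Class₂ membership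
of `Z` is the dichotomy of `nose_residue_singularCurve_dichotomy`.) [folklore] -/
theorem exists_singularCurve_three (k : Type) [Field k] (H : Scheme.{0}) (ι : H ⟶ (projectiveSpace 3 k).left)
    [IsClosedImmersion ι] [IsIntegral H] (hH : ¬ Literature.AlgebraicGeometry.Resolution.Scheme.IsRegular H)
    (hinf : ¬ Set.Finite {x : H | ¬ IsRegularLocalRing (H.presheaf.stalk x)}) :
    ∃ (Z : Set (projectiveSpace 3 k).left) (hZ : IsClosed Z), IsIrreducible Z ∧ Z.Infinite ∧
      Z ⊆ ι '' {x : H | ¬ IsRegularLocalRing (H.presheaf.stalk x)} ∧ Z ⊆ Set.range ι ∧ ¬ (Set.range ι ⊆ Z) ∧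
      ∀ z : ↥(redSub (projectiveSpace 3 k).left Z hZ), IsClosed ({z} : Set ↥(redSub (projectiveSpace 3 k).left Z hZ)) →
        ringKrullDim ((redSub (projectiveSpace 3 k).left Z hZ).presheaf.stalk z) = ((1 : ℕ) : WithBot ℕ∞) := by
  obtain ⟨Z, hZc, hZirr, hZinf, hZS, hZr, hZn⟩ := exists_singularCurve k 3 H ι hinf
  exact ⟨Z, hZc, hZirr, hZinf, hZS, hZr, hZn, ringKrullDim_stalk_redSub_eq_one k H ι hH hZc hZirr hZinf hZr hZn⟩

end Summit.ResolutionOfSingularities.ResolutionOfSingularities.Cruxes.EquisingularLiftNat.Sections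

end
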